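import Mathlib.RingTheory.GradedAlgebra.Basic
import Mathlib.LinearAlgebra.Basis.Basic
import Mathlib.LinearAlgebra.LinearIndependent.Lemmas
import HarnessLib

/-!
# Crux `FrobeniusLadder.FRationalResolution` (stmt-ResolutionOfSingularities-15317), line `redirect`,
# stub `stub_diagonalizableQuotientResolution` — a graded ring with a homogeneous UNIT in every degree
# is FREE over its degree-zero part on those units (the `D(B)`-torsor structure of
# `Spec S^{(B_𝔔)} → Spec S₀` near a point; census item R3, first brick)

After coarsening by the unit-degree subgroup `B = B_𝔔` (`…StabilizerSubgroup`, `…Coarsening`), the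
intermediate ring `S^{(B)} = ⊕_{b ∈ B} S_b` is graded by `B` and, once the elements outside `𝔔` are
inverted, EVERY degree `b ∈ B` carries a homogeneous unit `u_b` (`isUnit_of_mem_unitDegrees`). This
file proves the structural consequence in the abstract: for a graded ring `T = ⊕_b T_b` with
homogeneous units `u_b ∈ T_b` for all `b`,

* `inv_mem_of_isUnit` — the inverse of a homogeneous unit of degree `b` is homogeneous of degree `−b`;
* `mem_grade_iff_exists_mul_unit` — `T_c = T_0 · u_c`;
* `exists_basis_of_homogeneous_units` — **`T` is a free `T_0`-module with basis `(u_b)_b`** (so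
  `T_0 → T` is finite free of rank `|B|`: the torsor is étale iff `|B|` is invertible — the tame
  case of R3 — and faithfully flat always — the input of `…FaithfullyFlatFieldDescent` for the
  `p`-part).

Honest label: brick of R3 (no stub closed; the localized setting and étaleness are not here). No
definitions, no named facts, no sorry. [folklore; cite: SGA3, Exp. VIII §4–5]
-/

noncomputable section

-- single-problem summit: the doubled namespace component is forced
set_option linter.dupNamespace false

open DirectSum

namespace Summit.ResolutionOfSingularities.ResolutionOfSingularities.Theorems.FRationalResolution.HomogeneousUnits

universe u v w

variable {k : Type u} [CommRing k] {B : Type w} [DecidableEq B] [AddCommGroup B] {T : Type v}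
  [CommRing T] [Algebra k T] (𝒯 : B → Submodule k T) [GradedAlgebra 𝒯]

/-- **The inverse of a homogeneous unit is homogeneous, of opposite degree**: if `u ∈ T_b` and
`u v = 1` then `v ∈ T_{−b}` (the `(−b)`-component `v'` of `v` already satisfies `u v' = 1`, being
the degree-`0` component of `u v = 1`, and inverses are unique). [folklore] -/
theorem inv_mem_of_isUnit {b : B} {u v : T} (hu : u ∈ 𝒯 b) (huv : u * v = 1) : v ∈ 𝒯 (-b) := by
  classical
  -- the `(-b)`-component of `v` is also an inverse of `u`
  have h0 : (decompose 𝒯 (u * v) (b + -b) : T) = u * (decompose 𝒯 v (-b) : T) :=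
    coe_decompose_mul_add_of_left_mem 𝒯 hu
  rw [add_neg_cancel, huv, decompose_of_mem_same 𝒯 (SetLike.one_mem_graded 𝒯)] at h0
  -- hence equal to `v`
  have hv : v = (decompose 𝒯 v (-b) : T) := by
    calc v = v * (u * (decompose 𝒯 v (-b) : T)) := by rw [← h0, mul_one]
      _ = (u * v) * (decompose 𝒯 v (-b) : T) := by ring
      _ = (decompose 𝒯 v (-b) : T) := by rw [huv, one_mul]
  rw [hv]
  exact (decompose 𝒯 v (-b)).2

/-- **`T_c = T_0 · u` for a homogeneous unit `u` of degree `c`**: `t ∈ T_c` iff `t = r u` with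
`r ∈ T_0` (namely `r = t u⁻¹`). [folklore] -/
theorem mem_grade_iff_exists_mul_unit {c : B} {u v : T} (hu : u ∈ 𝒯 c) (huv : u * v = 1) (t : T) :
    t ∈ 𝒯 c ↔ ∃ r ∈ 𝒯 0, t = r * u := by
  constructor
  · intro ht
    refine ⟨t * v, ?_, ?_⟩
    · have h := SetLike.mul_mem_graded ht (inv_mem_of_isUnit 𝒯 hu huv)
      rwa [add_neg_cancel] at h
    · rw [mul_assoc, mul_comm v u, huv, mul_one]
  · rintro ⟨r, hr, rfl⟩
    have h := SetLike.mul_mem_graded hr hu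
    rwa [zero_add] at h

/-- **A graded ring with a homogeneous unit in every degree is free over its degree-zero part on
those units.** If `u_b ∈ T_b` is a unit for every `b`, then `(u_b)_{b ∈ B}` is a basis of `T` as a
`T_0`-module. [folklore; cite: SGA3, Exp. VIII §4–5] -/
theorem exists_basis_of_homogeneous_units (u : B → T) (hu : ∀ b, u b ∈ 𝒯 b)
    (hunit : ∀ b, IsUnit (u b)) :
    ∃ basis : Module.Basis B (𝒯 0) T, ∀ b, basis b = u b := by
  classical
  -- inverses
  have hinv : ∀ b, ∃ v : T, u b * v = 1 := fun b => (hunit b).exists_right_inv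
  choose v hv using hinv
  -- linear independence: project a relation to each degree
  have hli : LinearIndependent (𝒯 0) u := by
    rw [linearIndependent_iff']
    intro s r hsum b hb
    -- the `b`-component of `Σ r_c • u_c` is `r_b u_b`
    have hcomp : ∀ c ∈ s, (decompose 𝒯 (r c • u c) b : T) = if c = b then (r b : T) * u b else 0 := by
      intro c _
      have hmem : (r c : T) * u c ∈ 𝒯 c := by
        have h := SetLike.mul_mem_graded (r c).2 (hu c)
        rwa [zero_add] at h
      rw [Algebra.smul_def, show algebraMap (𝒯 0) T (r c) = (r c : T) from rfl]
      by_cases hcb : c = b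
      · subst hcb
        rw [if_pos rfl, decompose_of_mem_same 𝒯 hmem]
      · rw [if_neg hcb, decompose_of_mem_ne 𝒯 hmem hcb]
    have hproj : ∑ c ∈ s, (decompose 𝒯 (r c • u c) b : T) = 0 := by
      have h := congrArg (GradedRing.proj 𝒯 b) hsum
      rw [map_sum, map_zero] at h
      simpa only [GradedRing.proj_apply] using h
    rw [Finset.sum_congr rfl hcomp, Finset.sum_ite_eq' s b, if_pos hb] at hproj
    -- `r_b u_b = 0` with `u_b` a unit
    have hrb : (r b : T) = 0 := by
      have h := congrArg (· * v b) hproj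
      simpa [mul_assoc, hv b] using h
    exact Subtype.ext hrb
  -- spanning: `t = Σ_b t_b`, `t_b = (t_b v_b) • u_b`
  have hsp : ⊤ ≤ Submodule.span (𝒯 0) (Set.range u) := by
    rintro t -
    rw [← sum_support_decompose 𝒯 t]
    refine Submodule.sum_mem _ fun b _ => ?_
    obtain ⟨r, hr, hrb⟩ :=
      (mem_grade_iff_exists_mul_unit 𝒯 (hu b) (hv b) _).mp (decompose 𝒯 t b).2
    rw [hrb, show r * u b = (⟨r, hr⟩ : 𝒯 0) • u b from by rw [Algebra.smul_def]; rfl]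
    exact Submodule.smul_mem _ _ (Submodule.subset_span (Set.mem_range_self b))
  exact ⟨Module.Basis.mk hli hsp, fun b => Module.Basis.mk_apply hli hsp b⟩

end Summit.ResolutionOfSingularities.ResolutionOfSingularities.Theorems.FRationalResolution.HomogeneousUnits

end
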